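import Summits.BirchSwinnertonDyer.BirchSwinnertonDyer.Theorems.Rank1ResidualJetShaVanishingOfGlobalDivisibility
import Summits.BirchSwinnertonDyer.BirchSwinnertonDyer.Theorems.Rank1ResidualJetCarrierNe
import Summits.BirchSwinnertonDyer.BirchSwinnertonDyer.Theorems.Rank1ResidualJetCarrierEndFormsLiteratureNoCV
import HarnessLib

/-!
# T1 JET (cell `bsd-jet`), road K — the class-free JET consumers with the Kolyvagin–McCallum fact
# `hMcU` STRUCK IN THE KERNEL (and, composing with road K's END FORMS, the reading binders `hJ` too):
# `Ш(E/ℚ)[p] = 0` ∕ `BSD(E,p)` at a Tamagawa certificate ⟸ named print only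

HONEST FRAMING (programme file `BSD-LIT2PART-PROGRAMME-v1.md` §HONESTY, verbatim): «no tranche here
proves BSD; ARM L moves the LITERAL column of an r ≤ 1 census into the kernel-proved-modulo-named-print
column; ARM P changes what «named print» is worth.» THEOREMS ONLY (seat `bsd-jet-pv-1`, session g9;
`--supports stmt-BirchSwinnertonDyer-14418`, helper); nothing is booked by this file; 0 classes move
(the JET@p∣N bookings of record stand on referee A's documentary strikes). Per curve; not a class theorem.

WHAT. The class-free consumers behind every by-name JET row — `JET.bsdp_of_carrierNeCertificate`
(bucket A, `q ≠ p`; pv-1 g0), `JET.bsdp_of_carrierMultCertificate` (bucket B, `q = p` multiplicative;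
pv-2), `JET.bsdp_of_carrierAddCertificate` (`p` additive; pv-2) — display the reading binder `hJ`
(K1 ∕ K3 ∕ K4) AND the named fact `hMcU = McCallum1991_padicValNat_card_sha_primary_add_le_of_globalDivisibility`
(Kolyvagin–McCallum Cor. 5.6, size XL, flag `McCallum91-padic-image`). They use `hMcU` only in the
certificate case `ord_p [E(K):ℤP] ≤ ord_p c_q`, i.e. at `t = M₀`, which is now the KERNEL theorem
`JET.DividedDescent.sha_primary_eq_bot_of_globalDivisibility` (this seat, g9: Gross §10 on the divided
Euler system, modulo {Poitou–Tate, [McC] 4.4, F1}). §0 is the carrier-blind core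
(`noPTorsion_of_heegnerCertificate_of_divisibility`: any supplier of global divisibility to depth
`t ≥ ord_p [E(K):ℤP]` gives `Ш(E/ℚ)[p] = 0`); §1 re-issues the bucket-A consumers with `hMcU` REPLACED by
{`hPT`, `h44`, `hF1`} and then with `hJ` fed by road K (`jetchevDivisibilityCarrierNe_of_literatureNoCV`,
`prop44_of_frobeniusCongruence`); §2 ∕ §3 the same for the carriers `q = p` multiplicative and `p`
additive. Net display of a JET consumer after this file: {[McC] Prop. 5.2 (`h52`), Poitou–Tate for
Selmer structures (`hPT`), F1, Gross Prop. 3.7 (2) (`h372`)} + {Kolyvagin (`hKo`), Shimura reciprocity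
(`hrec`), Darmon 3.6 (`hD36`), GZK (`hGZK`)} — NO reading binder, NO structure-theorem fact.
References: [cite: Jetchev2008, Cor. 1.5 (p. 812), Thm. 1.4] [cite: McCallumLMS1991, §5 Lemma 5.1,
Cor. 5.6] [cite: GrossLMS1991, Thm. 1.3, Prop. 2.3, §10] [cite: Miller2011LMS, Def. 1.1]
[cite: SerreAbelianLadic1968, IV-23 Lemma 3] [cite: Wuthrich2014, Lemma 20]. Design: no definitions;
`K : Type`. Axioms: `propext`, `Classical.choice`, `Quot.sound`.
-/

set_option autoImplicit false

noncomputable section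

open scoped Classical

open WeierstrassCurve Literature.NumberTheory.EllipticCurves
  Literature.NumberTheory.EllipticCurves.ModularForms Literature.NumberTheory.GaloisCohomology
  Literature.NumberTheory.EllipticCurves.Rank1Residual
  Summit.BirchSwinnertonDyer.Rank1Residual Summit.BirchSwinnertonDyer.Rank1Residual.X11b

namespace Summit.BirchSwinnertonDyer.Rank1Residual.JET

/-- The two-conjunct Poitou–Tate fact (`poitouTate_sum_localTatePairing_eq_zero`) from bsd-jet's
five-conjunct conjugation-compatible form (forget three conjuncts). [cite: MilneADT2006, Ch. I Thm. 4.10(b), Cor. 2.3] -/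
theorem poitouTate_sum_of_selmerStructure_conj {K : Type} [Field K] [NumberField K]
    (h : poitouTate_selmerStructure_duality_conj K) : poitouTate_sum_localTatePairing_eq_zero K := by
  intro n _
  obtain ⟨inv, h1, h2, -, -, -⟩ := h n
  exact ⟨inv, h1, h2⟩

/-! ### §0 The carrier-blind core: a depth-`t` divisibility supplier with `t ≥ ord_p [E(K):ℤP]` gives `Ш(E/ℚ)[p] = 0` -/

/-- **Core: `Ш(E/ℚ)[p] = 0` from global divisibility to a depth `t ≥ ord_p [E(K):ℤP]`, via the divided
descent.** For `W/ℚ` globally minimal non-CM, an odd `p` with the `p`-adic tower onto, `K` imaginary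
quadratic (Heegner for `N_E`, `d_K ∉ {−3,−4}`), a Heegner point `P` of infinite order, a depth `t` with
`ord_p [E(K):ℤP] ≤ t`, and a supplier `hJt` of `p^s`-divisibility of the derived Heegner points for
every `s ≤ t` on every frame whose conductor-`1` derived point has infinite order (the common shape of
the reading binders K1 ∕ K3 ∕ K4): the frame and `d₁` of `P` (Darmon 3.6, Shimura reciprocity),
`p^{M₀} ∥ P` with `M₀ = ord_p [E(K):ℤP] ≤ t` (Mordell–Weil; McCallum Lemma 5.1 over `rank E(K) = 1`,
Kolyvagin), `DividedDescent.sha_primary_eq_bot_of_globalDivisibility` at depth `M₀`, and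
`Ш(E/ℚ)[p] ↪ Ш(E/K)` (`p` odd, `[K:ℚ] = 2`). CONDITIONAL on `hPT`, `h44`, `hF1`, `hKo`, `hrec`, `hD36`.
[cite: McCallumLMS1991, §5 Lemma 5.1, Cor. 5.6] [cite: GrossLMS1991, Thm. 1.3, §10] [cite: Jetchev2008, Cor. 1.5] -/
theorem noPTorsion_of_heegnerCertificate_of_divisibility
    (W : WeierstrassCurve ℚ) [W.IsElliptic] [W.IsGloballyMinimal] [NeZero (W.conductorNorm ℤ)]
    (hcm : ¬ W.HasCM) (K : Type) [Field K] [NumberField K]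
    (hPT : poitouTate_sum_localTatePairing_eq_zero K)
    (h44 : McCallum1991.prop44_localOrder_kolyvaginClass_mul_eq)
    (hF1 : Gross1991_heegnerPoint_sub_ratTorsion_mem_E0)
    (hKo : kolyvagin (W.conductorNorm ℤ) W K)
    (hrec : heegnerPointOfConductor_one_galoisConj (W.conductorNorm ℤ) W K)
    (hD36 : phi_heegnerTau_mem_singularModuliField (W.conductorNorm ℤ) W K)
    (hK : IsImaginaryQuadratic K)
    (hD3 : NumberField.discr K ≠ -3) (hD4 : NumberField.discr K ≠ -4)
    (hH : SatisfiesHeegnerHypothesis (W.conductorNorm ℤ) K)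
    (p : ℕ) [Fact p.Prime] (hp2 : p ≠ 2)
    (htower : ∀ n : ℕ, W.HasSurjectiveModNGaloisRep (p ^ n : ℕ))
    {P : (W.baseChange K).toAffine.Point} (hP : IsHeegnerPoint (W.conductorNorm ℤ) W K P)
    (hnt : ¬ IsOfFinAddOrder P) (t : ℕ)
    (hJt : ∀ (Dt : ModularParametrizationData W (W.conductorNorm ℤ)) (β : ℤ) (ι : K →+* ℂ)
      (d₁ : KolyvaginHeegnerData Dt β ι 1), ¬ IsOfFinAddOrder d₁.derivedPoint →
      ∀ (s : ℕ), s ≤ t → ∀ (n : ℕ) (d : KolyvaginHeegnerData Dt β ι n), Squarefree n →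
        (∀ ℓ ∈ n.primeFactors, Zhang2014.IsKolyvaginPrime (W.conductorNorm ℤ) W K p ℓ ∧
          s ≤ Zhang2014.kolyvaginIndex W p ℓ) →
        ∃ Q : (W.baseChange (ringClassField K ι n)).toAffine.Point,
          ((p ^ s : ℕ) : ℤ) • Q = d.derivedPoint)
    (hI : padicValNat p (AddSubgroup.zmultiples P).index ≤ t) :
    ∀ x : W.sha, (p : ℤ) • x = 0 → x = 0 := by
  have hp : p.Prime := Fact.out
  have hP' := hP
  have hsurj : W.HasSurjectiveModNGaloisRep (p : ℤ) := by simpa using htower 1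
  -- rank one over `K` (Kolyvagin)
  obtain ⟨hrank, -⟩ := hKo hK hH hP hnt
  -- a frame of `P` and a conductor-1 datum on it (Darmon 3.6), with bottom point `P` (Shimura)
  obtain ⟨Dt, H, ι, hPc⟩ := hP
  obtain ⟨d₁⟩ := exists_kolyvaginHeegnerData_one hD36 hK Dt H.β ι H.dvd_sq_sub
  have hPd : d₁.toGeomPoints d₁.derivedPoint = toGeomPoints (W.baseChange K) P :=
    KolyvaginBottom.toGeomPoints_derivedPoint_one_eq hrec hK hH hPc d₁ rfl
  -- `P_1` has infinite order since `P` has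
  have hy₁ : ¬ IsOfFinAddOrder d₁.derivedPoint := by
    intro hfin
    apply hnt
    have h1 : IsOfFinAddOrder (d₁.toGeomPoints d₁.derivedPoint) :=
      d₁.toGeomPoints.isOfFinAddOrder hfin
    rw [hPd] at h1
    exact (toGeomPoints_injective (W.baseChange K)).isOfFinAddOrder_iff.mp h1
  -- the exponent `p^{M₀} ∥ P` (Mordell–Weil)
  haveI : Module.Finite ℤ (W.baseChange K).toAffine.Point := (W.baseChange K).module_finite_point_holds
  obtain ⟨M₀, x₀, hx₀, hmax⟩ := exists_pow_smul_eq_and_forall_ne hnt (p := p) hp.two_le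
  have hdiv : ∃ Q : (W.baseChange K).toAffine.Point, ((p ^ M₀ : ℕ) : ℤ) • Q = P :=
    ⟨x₀, by rw [natCast_zsmul]; exact hx₀⟩
  have hndiv : ¬ ∃ Q : (W.baseChange K).toAffine.Point, ((p ^ (M₀ + 1) : ℕ) : ℤ) • Q = P := by
    rintro ⟨Q, hQ⟩
    exact hmax Q (by rw [← natCast_zsmul]; exact hQ)
  -- no `p`-torsion in `E(K)`: `E[p]` irreducible (from surjectivity mod `p`), `K` quadratic
  haveI : NeZero (p : ℚ) := ⟨Nat.cast_ne_zero.mpr hp.ne_zero⟩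
  have hirr : W.HasIrreducibleModPGaloisRep p :=
    hasIrreducibleModPGaloisRep_of_hasSurjectiveModNGaloisRep W p hsurj
  have hbot := torsionBy_eq_bot_of_isImaginaryQuadratic_of_hasIrreducibleModPGaloisRep W K hK hp hirr
  have hiv : ∀ x : (W.baseChange K).toAffine.Point, p • x = 0 → x = 0 := fun x hx ↦ by
    have hmem : x ∈ AddSubgroup.torsionBy (W.baseChange K).toAffine.Point ((p : ℕ) : ℤ) := by
      rw [mem_torsionBy_iff, natCast_zsmul]
      exact hx
    rw [hbot] at hmem
    exact hmem
  -- `ord_p [E(K):ℤP] = M₀` (McCallum Lemma 5.1 over Mordell–Weil), hence `M₀ ≤ t`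
  haveI : Finite (AddCommGroup.torsion (W.baseChange K).toAffine.Point) :=
    WeierstrassCurve.finite_torsion_point (W := W.baseChange K)
  obtain ⟨c, Q, hcQ, hcker⟩ := RankOne.exists_coord_of_mordellWeilRank_eq_one (W.baseChange K) hrank
  have hidx : padicValNat p (AddSubgroup.zmultiples P).index = M₀ :=
    Three.Koly.padicValNat_index_zmultiples_eq_of_divisibility c Q hcQ hcker hiv P hdiv hndiv
  have hM₀t : M₀ ≤ t := hidx ▸ hI
  -- ### `Ш(E/K)[p^∞] = 0` by the divided descent, fed at depth `M₀` by the supplier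
  have hsha : AddCommGroup.primaryComponent (W.baseChange K).sha p = ⊥ :=
    DividedDescent.sha_primary_eq_bot_of_globalDivisibility W hcm K hK hD3 hD4 hH p hp2 htower Dt H.β ι
      d₁ P hPd hP' hnt M₀ hndiv (fun n d hn hℓ ↦ hJt Dt H.β ι d₁ hy₁ M₀ hM₀t n d hn hℓ) hPT h44 hF1
  have hK0 : ∀ z : (W.baseChange K).sha, (p : ℤ) • z = 0 → z = 0 := by
    intro z hz
    have hmem : z ∈ AddCommGroup.primaryComponent (W.baseChange K).sha p := by
      rw [AddCommGroup.mem_primaryComponent]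
      exact ⟨1, by rw [pow_one, ← natCast_zsmul]; exact hz⟩
    rw [hsha] at hmem
    exact (AddSubgroup.mem_bot).mp hmem
  -- ### descent to `ℚ`: `Ш(E/ℚ)[p] ↪ Ш(E/K)[p]` (`p` odd, `[K:ℚ] = 2`)
  haveI : IsGalois ℚ K := by
    haveI : Algebra.IsQuadraticExtension ℚ K := ⟨hK.1⟩
    infer_instance
  have hcop : p.Coprime (Module.finrank ℚ K) := by
    rw [hK.1]
    exact (Nat.coprime_primes hp Nat.prime_two).mpr hp2
  intro x hx
  have hxn : p • x = 0 := by rw [← natCast_zsmul]; exact hx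
  have hres : shaRestriction W K x = 0 :=
    hK0 _ (by rw [← map_zsmul, hx, map_zero])
  have hx_mem : x ∈ (AddSubgroup.torsionBy W.sha p : Set W.sha) :=
    AddSubgroup.torsionBy.nsmul_iff.mpr hxn
  have h0_mem : (0 : W.sha) ∈ (AddSubgroup.torsionBy W.sha p : Set W.sha) :=
    AddSubgroup.torsionBy.nsmul_iff.mpr (smul_zero _)
  exact injOn_shaRestriction_torsionBy W K hcop hx_mem h0_mem (by rw [hres, map_zero])

/-! ### §1 Bucket A (`q ≠ p`): `hMcU` replaced by {Poitou–Tate, [McC] 4.4, F1}; then `hJ` fed by road K -/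

/-- **`Ш(E/ℚ)[p] = 0` from the bucket-A certificate — `noPTorsion_of_carrierNeCertificate` with the
Kolyvagin–McCallum fact `hMcU` REPLACED by {`hPT`, `h44`, `hF1`}** (same frame; one prime `q ∣ N`,
`q ≠ p`, with `ord_p [E(K):ℤP] ≤ ord_p c_q`). CONDITIONAL on the reading binder `hJ` and the
published `hPT`, `h44`, `hF1`, `hKo`, `hrec`, `hD36`. [cite: Jetchev2008, Cor. 1.5 (p. 812)]
[cite: McCallumLMS1991, §5 Lemma 5.1, Cor. 5.6] [cite: GrossLMS1991, Thm. 1.3, §10] -/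
theorem noPTorsion_of_carrierNeCertificate_of_divisibility
    (hJ : JetchevDivisibilityCarrierNe)
    (W : WeierstrassCurve ℚ) [W.IsElliptic] [W.IsGloballyMinimal] [NeZero (W.conductorNorm ℤ)]
    (K : Type) [Field K] [NumberField K]
    (hPT : poitouTate_sum_localTatePairing_eq_zero K)
    (h44 : McCallum1991.prop44_localOrder_kolyvaginClass_mul_eq)
    (hF1 : Gross1991_heegnerPoint_sub_ratTorsion_mem_E0)
    (hKo : kolyvagin (W.conductorNorm ℤ) W K)
    (hrec : heegnerPointOfConductor_one_galoisConj (W.conductorNorm ℤ) W K)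
    (hD36 : phi_heegnerTau_mem_singularModuliField (W.conductorNorm ℤ) W K)
    (hK : IsImaginaryQuadratic K)
    (hD3 : NumberField.discr K ≠ -3) (hD4 : NumberField.discr K ≠ -4)
    (hH : SatisfiesHeegnerHypothesis (W.conductorNorm ℤ) K)
    (p : ℕ) [Fact p.Prime] (hp2 : p ≠ 2)
    (htower : ∀ n : ℕ, W.HasSurjectiveModNGaloisRep (p ^ n : ℕ))
    {P : (W.baseChange K).toAffine.Point} (hP : IsHeegnerPoint (W.conductorNorm ℤ) W K P)
    (hnt : ¬ IsOfFinAddOrder P)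
    (q : ℕ) [Fact q.Prime] (hq : q ∣ W.conductorNorm ℤ) (hqp : q ≠ p)
    (hI : padicValNat p (AddSubgroup.zmultiples P).index ≤
      padicValNat p ((W.baseChange ℚ_[q]).localTamagawaNumber ℤ_[q])) :
    ∀ x : W.sha, (p : ℤ) • x = 0 → x = 0 := by
  have hsurj : W.HasSurjectiveModNGaloisRep (p : ℤ) := by simpa using htower 1
  have hcm : ¬ W.HasCM := fun hCM ↦
    W.not_hasSurjectiveModNGaloisRep_of_hasCM hCM (Fact.out : p.Prime) hp2 (by simpa using hsurj)
  exact noPTorsion_of_heegnerCertificate_of_divisibility W hcm K hPT h44 hF1 hKo hrec hD36 hK hD3 hD4 hH p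
    hp2 htower hP hnt _
    (fun Dt β ι d₁ hy₁ s hs n d hn hℓ ↦ hJ W hcm K hK hD3 hD4 hH p hp2 htower Dt β ι d₁ hy₁ q hq hqp s hs
      n d hn hℓ) hI

/-- **`BSD(E,p)` from the bucket-A certificate ⟸ NAMED PRINT ONLY** (`p` odd, `p`-adic tower onto):
`bsdp_of_carrierNeCertificate` with BOTH the reading binder `hJ` (fed by road K's END FORM
`jetchevDivisibilityCarrierNe_of_literatureNoCV h52 hPT hF1 h372`) and the structure fact `hMcU`
(replaced by the divided descent; Poitou–Tate from `hPT K`, [McC] 4.4 from (A′) by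
`prop44_of_frobeniusCongruence`) STRUCK. Displayed: {`h52`, `hPT` (∀ K), `hF1`, `h372`} + {`hKo`, `hrec`,
`hD36`, `hGZK`}. Per curve; nothing booked here. [cite: Jetchev2008, Cor. 1.5, Thm. 1.4]
[cite: Miller2011LMS, Def. 1.1] [cite: McCallumLMS1991, Prop. 5.2, Cor. 5.6] -/
theorem bsdp_of_carrierNeCertificate_of_literature
    (h52 : McCallum1991.prop52_exists_conductor_kolyvaginClass_order_eq)
    (hPT : ∀ (K : Type) [Field K] [NumberField K], poitouTate_selmerStructure_duality_conj K)
    (hF1 : Gross1991_heegnerPoint_sub_ratTorsion_mem_E0)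
    (h372 : GrossLMS1991.prop37_2_frobeniusCongruence)
    (hGZK : rank_eq_analyticRank_of_analyticRank_le_one)
    (W : WeierstrassCurve ℚ) [W.IsElliptic] [W.IsGloballyMinimal] [NeZero (W.conductorNorm ℤ)]
    (K : Type) [Field K] [NumberField K]
    (hKo : kolyvagin (W.conductorNorm ℤ) W K)
    (hrec : heegnerPointOfConductor_one_galoisConj (W.conductorNorm ℤ) W K)
    (hD36 : phi_heegnerTau_mem_singularModuliField (W.conductorNorm ℤ) W K)
    (hK : IsImaginaryQuadratic K)
    (hD3 : NumberField.discr K ≠ -3) (hD4 : NumberField.discr K ≠ -4)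
    (hH : SatisfiesHeegnerHypothesis (W.conductorNorm ℤ) K)
    (p : ℕ) [Fact p.Prime] (hp2 : p ≠ 2)
    (htower : ∀ n : ℕ, W.HasSurjectiveModNGaloisRep (p ^ n : ℕ))
    {P : (W.baseChange K).toAffine.Point} (hP : IsHeegnerPoint (W.conductorNorm ℤ) W K P)
    (hnt : ¬ IsOfFinAddOrder P)
    (q : ℕ) [Fact q.Prime] (hq : q ∣ W.conductorNorm ℤ) (hqp : q ≠ p)
    (hI : padicValNat p (AddSubgroup.zmultiples P).index ≤
      padicValNat p ((W.baseChange ℚ_[q]).localTamagawaNumber ℤ_[q]))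
    (hr : W.analyticRank ≤ 1) {s : ℚ} (hs : shaAn W = (s : ℂ)) (hv : padicValRat p s = 0) :
    BSDp W p :=
  Typed.bsdp_of_shaAn_unit_of_noPTorsion W p hGZK hr hs hv
    (noPTorsion_of_carrierNeCertificate_of_divisibility
      (jetchevDivisibilityCarrierNe_of_literatureNoCV h52 hPT hF1 h372) W K
      (poitouTate_sum_of_selmerStructure_conj (hPT K)) (prop44_of_frobeniusCongruence h372) hF1 hKo hrec
      hD36 hK hD3 hD4 hH p hp2 htower hP hnt q hq hqp hI)

/-- **`BSD(E,p)` from the bucket-A certificate ⟸ named print only, `p ≥ 5`**: the `p`-adic tower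
DISCHARGED from `ρ̄_{E,p}` onto (Serre, `serre_hasSurjectiveModNGaloisRep_pow_holds`) — the register's
galrep datum as recorded; `bsdp_of_carrierNeCertificate_of_five_le` with `hJ` and `hMcU` struck.
[cite: Jetchev2008, Cor. 1.5] [cite: SerreAbelianLadic1968, Ch. IV §3.4 Lemma 3 (IV-23)] [cite: Miller2011LMS, Def. 1.1] -/
theorem bsdp_of_carrierNeCertificate_of_five_le_of_literature
    (h52 : McCallum1991.prop52_exists_conductor_kolyvaginClass_order_eq)
    (hPT : ∀ (K : Type) [Field K] [NumberField K], poitouTate_selmerStructure_duality_conj K)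
    (hF1 : Gross1991_heegnerPoint_sub_ratTorsion_mem_E0)
    (h372 : GrossLMS1991.prop37_2_frobeniusCongruence)
    (hGZK : rank_eq_analyticRank_of_analyticRank_le_one)
    (W : WeierstrassCurve ℚ) [W.IsElliptic] [W.IsGloballyMinimal] [NeZero (W.conductorNorm ℤ)]
    (K : Type) [Field K] [NumberField K]
    (hKo : kolyvagin (W.conductorNorm ℤ) W K)
    (hrec : heegnerPointOfConductor_one_galoisConj (W.conductorNorm ℤ) W K)
    (hD36 : phi_heegnerTau_mem_singularModuliField (W.conductorNorm ℤ) W K)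
    (hK : IsImaginaryQuadratic K)
    (hD3 : NumberField.discr K ≠ -3) (hD4 : NumberField.discr K ≠ -4)
    (hH : SatisfiesHeegnerHypothesis (W.conductorNorm ℤ) K)
    (p : ℕ) [Fact p.Prime] (h5 : 5 ≤ p) (hsurj : W.HasSurjectiveModNGaloisRep p)
    {P : (W.baseChange K).toAffine.Point} (hP : IsHeegnerPoint (W.conductorNorm ℤ) W K P)
    (hnt : ¬ IsOfFinAddOrder P)
    (q : ℕ) [Fact q.Prime] (hq : q ∣ W.conductorNorm ℤ) (hqp : q ≠ p)
    (hI : padicValNat p (AddSubgroup.zmultiples P).index ≤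
      padicValNat p ((W.baseChange ℚ_[q]).localTamagawaNumber ℤ_[q]))
    (hr : W.analyticRank ≤ 1) {s : ℚ} (hs : shaAn W = (s : ℂ)) (hv : padicValRat p s = 0) :
    BSDp W p := by
  have hp2 : p ≠ 2 := by omega
  exact bsdp_of_carrierNeCertificate_of_literature h52 hPT hF1 h372 hGZK W K hKo hrec hD36 hK hD3 hD4 hH
    p hp2 (serre_hasSurjectiveModNGaloisRep_pow_holds W p h5 hsurj) hP hnt q hq hqp hI hr hs hv

/-! ### §2 Bucket B (`q = p` multiplicative) ⟸ named print only -/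

/-- **`BSD(E,p)` from the bucket-B certificate (`p` odd MULTIPLICATIVE, `ord_p [E(K):ℤP] ≤ ord_p c_p`,
`ρ̄_{E,p}` onto — the tower by the Tate line) ⟸ NAMED PRINT ONLY**: pv-2's
`bsdp_of_carrierMultCertificate_of_surj` with the reading binder K3 fed by road K
(`jetchevDivisibilityCarrierMult_of_literatureNoCV`) and `hMcU` replaced by the divided descent.
Displayed: {`h52`, `hPT` (∀ K), `hF1`, `h372`} + {`hKo`, `hrec`, `hD36`, `hGZK`}. Per pair; nothing booked.
[cite: Jetchev2008, Cor. 1.5, Thm. 1.4] [cite: Wuthrich2014, Lemma 20 (p. 399)] [cite: Miller2011LMS, Def. 1.1] -/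
theorem bsdp_of_carrierMultCertificate_of_surj_of_literature
    (h52 : McCallum1991.prop52_exists_conductor_kolyvaginClass_order_eq)
    (hPT : ∀ (K : Type) [Field K] [NumberField K], poitouTate_selmerStructure_duality_conj K)
    (hF1 : Gross1991_heegnerPoint_sub_ratTorsion_mem_E0)
    (h372 : GrossLMS1991.prop37_2_frobeniusCongruence)
    (hGZK : rank_eq_analyticRank_of_analyticRank_le_one)
    (W : WeierstrassCurve ℚ) [W.IsElliptic] [W.IsGloballyMinimal] [NeZero (W.conductorNorm ℤ)]
    (K : Type) [Field K] [NumberField K]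
    (hKo : kolyvagin (W.conductorNorm ℤ) W K)
    (hrec : heegnerPointOfConductor_one_galoisConj (W.conductorNorm ℤ) W K)
    (hD36 : phi_heegnerTau_mem_singularModuliField (W.conductorNorm ℤ) W K)
    (hK : IsImaginaryQuadratic K) (hD3 : NumberField.discr K ≠ -3) (hD4 : NumberField.discr K ≠ -4)
    (hH : SatisfiesHeegnerHypothesis (W.conductorNorm ℤ) K)
    (p : ℕ) [Fact p.Prime] (hp2 : p ≠ 2) (hmult : W.HasMultiplicativeReductionAtPrime p)
    (hsurj : W.HasSurjectiveModNGaloisRep p)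
    {P : (W.baseChange K).toAffine.Point} (hP : IsHeegnerPoint (W.conductorNorm ℤ) W K P)
    (hnt : ¬ IsOfFinAddOrder P)
    (hI : padicValNat p (AddSubgroup.zmultiples P).index ≤
      padicValNat p ((W.baseChange ℚ_[p]).localTamagawaNumber ℤ_[p]))
    (hr : W.analyticRank ≤ 1) {s : ℚ} (hs : shaAn W = (s : ℂ)) (hv : padicValRat p s = 0) :
    BSDp W p := by
  have hcm : ¬ W.HasCM := not_hasCM_of_hasMultiplicativeReductionAtPrime' W hmult
  have htower : ∀ n : ℕ, W.HasSurjectiveModNGaloisRep (p ^ n : ℕ) := fun n ↦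
    W.forall_hasSurjectiveModNGaloisRep_pow_of_multiplicative_of_surj p hp2 hmult hsurj n
  have hJ : JetchevDivisibilityCarrierMult := jetchevDivisibilityCarrierMult_of_literatureNoCV h52 hPT hF1 h372
  exact Typed.bsdp_of_shaAn_unit_of_noPTorsion W p hGZK hr hs hv
    (noPTorsion_of_heegnerCertificate_of_divisibility W hcm K (poitouTate_sum_of_selmerStructure_conj (hPT K))
      (prop44_of_frobeniusCongruence h372) hF1 hKo hrec hD36 hK hD3 hD4 hH p hp2 htower hP hnt _
      (fun Dt β ι d₁ hy₁ s hs n d hn hℓ ↦ hJ W hcm K hK hD3 hD4 hH p hp2 hmult htower Dt β ι d₁ hy₁ s hs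
        n d hn hℓ) hI)

/-! ### §3 Carrier `p` additive ⟸ named print only -/

/-- **`BSD(E,p)` from the additive-carrier certificate (`p` odd ADDITIVE, `ord_p [E(K):ℤP] ≤ ord_p c_p`,
`p`-adic tower onto) ⟸ NAMED PRINT ONLY**: pv-2's `bsdp_of_carrierAddCertificate` with the reading
binder K4 fed by road K (`jetchevDivisibilityCarrierAdd_of_literatureNoCV`) and `hMcU` replaced by the
divided descent. Displayed: {`h52`, `hPT` (∀ K), `hF1`, `h372`} + {`hKo`, `hrec`, `hD36`, `hGZK`}.
[cite: Jetchev2008, Cor. 1.5, Thm. 1.4] [cite: Miller2011LMS, Def. 1.1] [cite: McCallumLMS1991, Cor. 5.6] -/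
theorem bsdp_of_carrierAddCertificate_of_literature
    (h52 : McCallum1991.prop52_exists_conductor_kolyvaginClass_order_eq)
    (hPT : ∀ (K : Type) [Field K] [NumberField K], poitouTate_selmerStructure_duality_conj K)
    (hF1 : Gross1991_heegnerPoint_sub_ratTorsion_mem_E0)
    (h372 : GrossLMS1991.prop37_2_frobeniusCongruence)
    (hGZK : rank_eq_analyticRank_of_analyticRank_le_one)
    (W : WeierstrassCurve ℚ) [W.IsElliptic] [W.IsGloballyMinimal] [NeZero (W.conductorNorm ℤ)]
    (K : Type) [Field K] [NumberField K]
    (hKo : kolyvagin (W.conductorNorm ℤ) W K)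
    (hrec : heegnerPointOfConductor_one_galoisConj (W.conductorNorm ℤ) W K)
    (hD36 : phi_heegnerTau_mem_singularModuliField (W.conductorNorm ℤ) W K)
    (hK : IsImaginaryQuadratic K) (hD3 : NumberField.discr K ≠ -3) (hD4 : NumberField.discr K ≠ -4)
    (hH : SatisfiesHeegnerHypothesis (W.conductorNorm ℤ) K)
    (p : ℕ) [Fact p.Prime] (hp2 : p ≠ 2) (hng : ¬ W.HasGoodReductionAtPrime p)
    (hnm : ¬ W.HasMultiplicativeReductionAtPrime p)
    (htower : ∀ n : ℕ, W.HasSurjectiveModNGaloisRep (p ^ n : ℕ))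
    {P : (W.baseChange K).toAffine.Point} (hP : IsHeegnerPoint (W.conductorNorm ℤ) W K P)
    (hnt : ¬ IsOfFinAddOrder P)
    (hI : padicValNat p (AddSubgroup.zmultiples P).index ≤
      padicValNat p ((W.baseChange ℚ_[p]).localTamagawaNumber ℤ_[p]))
    (hr : W.analyticRank ≤ 1) {s : ℚ} (hs : shaAn W = (s : ℂ)) (hv : padicValRat p s = 0) :
    BSDp W p := by
  have hsurj : W.HasSurjectiveModNGaloisRep (p : ℤ) := by simpa using htower 1
  have hcm : ¬ W.HasCM := fun hCM ↦
    W.not_hasSurjectiveModNGaloisRep_of_hasCM hCM (Fact.out : p.Prime) hp2 (by simpa using hsurj)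
  have hJ : JetchevDivisibilityCarrierAdd := jetchevDivisibilityCarrierAdd_of_literatureNoCV h52 hPT hF1 h372
  exact Typed.bsdp_of_shaAn_unit_of_noPTorsion W p hGZK hr hs hv
    (noPTorsion_of_heegnerCertificate_of_divisibility W hcm K (poitouTate_sum_of_selmerStructure_conj (hPT K))
      (prop44_of_frobeniusCongruence h372) hF1 hKo hrec hD36 hK hD3 hD4 hH p hp2 htower hP hnt _
      (fun Dt β ι d₁ hy₁ s hs n d hn hℓ ↦ hJ W hcm K hK hD3 hD4 hH p hp2 hng hnm htower Dt β ι d₁ hy₁ s hs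
        n d hn hℓ) hI)

end Summit.BirchSwinnertonDyer.Rank1Residual.JET

end
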